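import Mathlib.Analysis.Complex.RealDeriv
import Mathlib.Analysis.Calculus.Deriv.Mul
import Mathlib.Analysis.SpecialFunctions.Exponential
import Literature.MathematicalPhysics.QuantumLattice.FermionGammaFunctorTrace
import HarnessLib

/-!
# The derivative of the second-quantisation functor: `dΓ` is the differential of `Γ`

Topic `Literature/MathematicalPhysics/QuantumLattice`; companion of `FermionGammaFunctor` (`Gamma g = ⊕ₖ Λᵏ g`,
the matrix of minors of a one-body matrix `g` on the Jordan–Wigner Fock space `Fock ι = Finset ι → ℂ`,
`Γ(gh) = Γ(g)Γ(h)`) and `FermionGammaFunctorTrace` (`e^{dΓ(A)} = Γ(e^{A})`), where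
`dGamma Y = Σᵢⱼ Yᵢⱼ c†ᵢ cⱼ` (`FermionQuasiFree`) is the second quantisation of the one-particle matrix `Y`.
All statements PROVED, no definition introduced. Main results (entrywise, i.e. for the scalar functions
`s ↦ ⟨S| Γ(γ(s)) |T⟩`, so that no matrix norm has to be chosen in the statements):

* `hasDerivAt_Gamma_one_add_smul_apply` — **`d/ds|₀ Γ(1 + sY) = dΓ(Y)`**: the second quantisation `dΓ`
  is the differential of the functor `Γ` at the identity (Dereziński–Gérard Prop. 3.23 (1):
  `Γ(e^{th}) = e^{t dΓ(h)}`, differentiated at `t = 0`; Bratteli–Robinson II §5.2.1);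
* `hasDerivAt_Gamma_mul_one_add_smul_apply` — **`d/ds|₀ Γ(g(1 + sY)) = Γ(g) dΓ(Y)`** for an ARBITRARY
  one-body matrix `g` (by functoriality), the form in which a quark bilinear inserted at one time slice of a
  transfer-matrix product `⋯ Γ(M_t(s)) ⋯`, `M_t(s) = M_t (1 + s Y_t)`, becomes the Fock operator `Γ(M_t) dΓ(Y_t)`;
* `hasDerivAt_Gamma_exp_smul_apply` — `d/ds Γ(e^{sY}) = dΓ(Y) Γ(e^{sY})` at every `s`.

## Proof

No sign bookkeeping is needed. (i) Along ANY entrywise differentiable matrix path `γ` the minors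
`⟨S|Γ(γ(s))|T⟩ = det γ(s)[S,T]` are differentiable, with a derivative given by the Leibniz expansion that
depends only on `(γ(s₀), γ'(s₀))` (`hasDerivAt_det_of_hasDerivAt_apply`,
`hasDerivAt_Gamma_apply_of_hasDerivAt_apply`), hence two paths with the same endpoint data have the same
derivative (`hasDerivAt_Gamma_apply_congr_path`). (ii) The paths `s ↦ 1 + sY` and `s ↦ e^{sY}` have the same
endpoint data `(1, Y)` at `s = 0`, and along the second one `Γ(e^{sY}) = e^{s dΓ(Y)}`
(`exp_dGamma_eq_Gamma_exp`) has derivative `dΓ(Y)` (`hasDerivAt_exp_smul_const'`).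

## Mathlib / tree search

Mathlib has the derivative of `u ↦ e^{uA}` in a complete normed algebra (`hasDerivAt_exp_smul_const'`), the
Leibniz formula `Matrix.det_apply'`, `HasDerivAt.fun_finsetProd` / `HasDerivAt.fun_sum`, and the passage from a
complex to a real parameter `HasDerivAt.comp_ofReal`; it has no derivative of `Matrix.det` along a curve
and nothing on `Γ`/`dΓ`. The tree's Jacobi formulas `Literature.Analysis.Calculus.hasDerivAt_det_rows`
(`LiouvilleDeterminant.lean`, row form via `detRowsCLM`) and `hasDerivAt_det_one_add_smul`
(`JacobiFormula.lean`) are stated for REAL matrices `ℝ → ι → ι → ℝ`; here the matrices are complex with a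
real parameter, and only the Leibniz form (whose value at `s₀` visibly depends on `(γ(s₀), γ'(s₀))` alone)
is needed, so it is proved directly in five lines (`hasDerivAt_det_of_hasDerivAt_apply`).
Tree (REUSED): `Gamma`, `Gamma_apply_of_card_eq/_ne`, `Gamma_one`, `Gamma_mul` (`FermionGammaFunctor`),
`dGamma`, `dGamma_smul` (`FermionQuasiFree`), `exp_dGamma_eq_Gamma_exp` (`FermionGammaFunctorTrace`).
The `L^∞` operator norm (`Matrix.Norms.Operator`) is opened only inside one proof.

## References

* J. Dereziński, C. Gérard, *Mathematics of Quantization and Quantum Fields*, CUP (2013; 2nd ed. 2022),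
  §3.2.2 Prop. 3.23 (1) (`Γ(e^{h}) = e^{dΓ(h)}`, `Γ(p₂)Γ(p₁) = Γ(p₂p₁)`), §3.3.3 Def. 3.34. [DerezinskiGerard2022]
* O. Bratteli, D. W. Robinson, *Operator Algebras and Quantum Statistical Mechanics 2*, 2nd ed.
  (Springer 1997), §5.2.1 (second quantisation `Γ(U)`, `dΓ(H)`, `Γ(e^{itH}) = e^{it dΓ(H)}`).
  [BratteliRobinsonII1997]
-/

noncomputable section

namespace Literature.MathematicalPhysics.QuantumLattice

open Matrix Finset NormedSpace

/-! ### Entries of `e^{sA}` and minors along a differentiable matrix path -/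

section Matrices

variable {n : Type*} [Fintype n] [DecidableEq n]

/-- The entries of `s ↦ e^{sA}` (real parameter `s`, complex matrix `A`) are differentiable, with
derivative the entries of `A e^{sA}`. [folklore] -/
theorem hasDerivAt_exp_smul_apply (A : Matrix n n ℂ) (a b : n) (s₀ : ℝ) :
    HasDerivAt (fun s : ℝ => exp ((s : ℂ) • A) a b) ((A * exp ((s₀ : ℂ) • A)) a b) s₀ := by
  open scoped Matrix.Norms.Operator in
  have h := (LinearMap.toContinuousLinearMap (Matrix.entryLinearMap ℂ ℂ a b)).hasFDerivAt.comp_hasDerivAt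
    ((s₀ : ℝ) : ℂ) (hasDerivAt_exp_smul_const' (𝕂 := ℂ) A ((s₀ : ℝ) : ℂ))
  exact h.comp_ofReal

/-- **Leibniz form of the derivative of a determinant along a matrix path.** If every entry of
`s ↦ γ(s)` is differentiable at `s₀` with derivative `γ'ᵢⱼ`, then `s ↦ det γ(s)` is differentiable at `s₀`
with derivative `Σ_σ sgn σ Σ_i (∏_{j ≠ i} γ(s₀)_{σj, j}) γ'_{σi, i}` (the product rule applied to the Leibniz
expansion; summing the inner sum gives Jacobi's `tr(adj γ · γ')`). [folklore] -/
theorem hasDerivAt_det_of_hasDerivAt_apply {γ : ℝ → Matrix n n ℂ} {γ' : Matrix n n ℂ} {s₀ : ℝ}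
    (hγ : ∀ i j, HasDerivAt (fun s => γ s i j) (γ' i j) s₀) :
    HasDerivAt (fun s => (γ s).det)
      (∑ σ : Equiv.Perm n, ((Equiv.Perm.sign σ : ℤ) : ℂ) *
        ∑ i, (∏ j ∈ univ.erase i, γ s₀ (σ j) j) * γ' (σ i) i) s₀ := by
  have hfun : (fun s => (γ s).det) =
      fun s => ∑ σ : Equiv.Perm n, ((Equiv.Perm.sign σ : ℤ) : ℂ) * ∏ i, γ s (σ i) i := by
    funext s
    exact Matrix.det_apply' (γ s)
  rw [hfun]
  refine HasDerivAt.fun_sum fun σ _ => ?_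
  have hp := HasDerivAt.fun_finsetProd (u := univ) (f := fun i s => γ s (σ i) i)
    (f' := fun i => γ' (σ i) i) (x := s₀) (fun i _ => hγ (σ i) i)
  simp only [smul_eq_mul] at hp
  exact hp.const_mul _

end Matrices

/-! ### Minors along a path: the derivative depends only on the endpoint data -/

variable {ι : Type*} [LinearOrder ι] [Fintype ι]

omit [Fintype ι] in
/-- The entries `⟨S|Γ(γ(s))|T⟩` of the second quantisation along an entrywise differentiable matrix path
`γ` are differentiable, with derivative the Leibniz expression in `(γ(s₀), γ'(s₀))` for the minor
`det γ(s)[S,T]` (rows `S`, columns `T` enumerated increasingly) when `|S| = |T|`, and `0` otherwise.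
[folklore] -/
theorem hasDerivAt_Gamma_apply_of_hasDerivAt_apply {γ : ℝ → Matrix ι ι ℂ} {Y : Matrix ι ι ℂ} {s₀ : ℝ}
    (hγ : ∀ i j, HasDerivAt (fun s => γ s i j) (Y i j) s₀) (S T : Finset ι) :
    HasDerivAt (fun s => Gamma (γ s) S T)
      (if h : S.card = T.card then
        ∑ σ : Equiv.Perm (Fin T.card), ((Equiv.Perm.sign σ : ℤ) : ℂ) *
          ∑ a, (∏ b ∈ univ.erase a, γ s₀ (S.orderEmbOfFin h (σ b)) (T.orderEmbOfFin rfl b)) *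
            Y (S.orderEmbOfFin h (σ a)) (T.orderEmbOfFin rfl a)
       else 0) s₀ := by
  by_cases h : S.card = T.card
  · rw [dif_pos h]
    have hfun : (fun s => Gamma (γ s) S T) =
        fun s => ((γ s).submatrix (S.orderEmbOfFin h) (T.orderEmbOfFin rfl)).det := by
      funext s
      exact Gamma_apply_of_card_eq (γ s) h rfl
    rw [hfun]
    exact hasDerivAt_det_of_hasDerivAt_apply
      (γ := fun s => (γ s).submatrix (S.orderEmbOfFin h) (T.orderEmbOfFin rfl))
      (γ' := Y.submatrix (S.orderEmbOfFin h) (T.orderEmbOfFin rfl)) fun a b => hγ _ _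
  · rw [dif_neg h]
    have hfun : (fun s => Gamma (γ s) S T) = fun _ => 0 := by
      funext s
      exact Gamma_apply_of_card_ne (γ s) h
    rw [hfun]
    exact hasDerivAt_const s₀ 0

omit [Fintype ι] in
/-- **Path independence of the derivative of `Γ`.** If two entrywise differentiable matrix paths
`γ₁, γ₂` agree at `s₀` together with their entrywise derivatives, then every entry of `Γ ∘ γ₁` has at `s₀`
the same derivative as the corresponding entry of `Γ ∘ γ₂` (the minors are polynomials in the entries).
[folklore] -/
theorem hasDerivAt_Gamma_apply_congr_path {γ₁ γ₂ : ℝ → Matrix ι ι ℂ} {Y : Matrix ι ι ℂ} {s₀ : ℝ}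
    (h₁ : ∀ i j, HasDerivAt (fun s => γ₁ s i j) (Y i j) s₀)
    (h₂ : ∀ i j, HasDerivAt (fun s => γ₂ s i j) (Y i j) s₀) (h₀ : γ₁ s₀ = γ₂ s₀)
    {S T : Finset ι} {D : ℂ} (hD : HasDerivAt (fun s => Gamma (γ₂ s) S T) D s₀) :
    HasDerivAt (fun s => Gamma (γ₁ s) S T) D s₀ := by
  have e₁ := hasDerivAt_Gamma_apply_of_hasDerivAt_apply h₁ S T
  have e₂ := hasDerivAt_Gamma_apply_of_hasDerivAt_apply h₂ S T
  rw [h₀] at e₁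
  rwa [e₂.unique hD] at e₁

/-! ### `dΓ` is the differential of `Γ` -/

/-- **`d/ds Γ(e^{sY}) = dΓ(Y) Γ(e^{sY})`** entrywise, at every real `s`: along the one-parameter group
`e^{sY}` the second quantisation is `Γ(e^{sY}) = e^{s dΓ(Y)}`. Dereziński–Gérard Prop. 3.23 (1);
Bratteli–Robinson II §5.2.1 (`Γ(e^{itH}) = e^{it dΓ(H)}`). [cite: DerezinskiGerard2022, Prop. 3.23] -/
theorem hasDerivAt_Gamma_exp_smul_apply (Y : Matrix ι ι ℂ) (S T : Finset ι) (s₀ : ℝ) :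
    HasDerivAt (fun s : ℝ => Gamma (exp ((s : ℂ) • Y)) S T)
      ((dGamma Y * Gamma (exp ((s₀ : ℂ) • Y))) S T) s₀ := by
  have h := hasDerivAt_exp_smul_apply (dGamma Y) S T s₀
  simp_rw [← dGamma_smul, exp_dGamma_eq_Gamma_exp] at h
  exact h

/-- **`dΓ(Y)` is the derivative of `Γ` at the identity in the direction `Y`**:
`d/ds|₀ ⟨S| Γ(1 + sY) |T⟩ = ⟨S| dΓ(Y) |T⟩` for every one-body matrix `Y` and all `S, T`, where
`dΓ(Y) = Σᵢⱼ Yᵢⱼ c†ᵢ cⱼ`. (The paths `1 + sY` and `e^{sY}` have the same first-order data at `s = 0`,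
and `Γ(e^{sY}) = e^{s dΓ(Y)}`.) Dereziński–Gérard Prop. 3.23 (1); Bratteli–Robinson II §5.2.1.
[cite: DerezinskiGerard2022, Prop. 3.23] -/
theorem hasDerivAt_Gamma_one_add_smul_apply (Y : Matrix ι ι ℂ) (S T : Finset ι) :
    HasDerivAt (fun s : ℝ => Gamma (1 + (s : ℂ) • Y) S T) (dGamma Y S T) 0 := by
  have h₁ : ∀ i j, HasDerivAt (fun s : ℝ => (1 + (s : ℂ) • Y) i j) (Y i j) 0 := by
    intro i j
    have h := (((hasDerivAt_id (0 : ℝ)).ofReal_comp).mul_const (Y i j)).const_add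
      ((1 : Matrix ι ι ℂ) i j)
    rw [Complex.ofReal_one, one_mul] at h
    have hfun : (fun s : ℝ => (1 + (s : ℂ) • Y) i j) =
        fun s : ℝ => (1 : Matrix ι ι ℂ) i j + ((id s : ℝ) : ℂ) * Y i j := by
      funext s
      rfl
    rwa [hfun]
  have h₂ : ∀ i j, HasDerivAt (fun s : ℝ => exp ((s : ℂ) • Y) i j) (Y i j) 0 := by
    intro i j
    have h := hasDerivAt_exp_smul_apply Y i j 0
    rwa [Complex.ofReal_zero, zero_smul, NormedSpace.exp_zero, Matrix.mul_one] at h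
  have h₀ : (1 + ((0 : ℝ) : ℂ) • Y) = exp (((0 : ℝ) : ℂ) • Y) := by
    rw [Complex.ofReal_zero, zero_smul, NormedSpace.exp_zero, add_zero]
  have hD := hasDerivAt_Gamma_exp_smul_apply Y S T 0
  rw [Complex.ofReal_zero, zero_smul, NormedSpace.exp_zero, Gamma_one, Matrix.mul_one] at hD
  exact hasDerivAt_Gamma_apply_congr_path h₁ h₂ h₀ hD

/-- **`d/ds|₀ Γ(g (1 + sY)) = Γ(g) dΓ(Y)`** entrywise, for ARBITRARY one-body matrices `g, Y`: the
derivative of the second-quantisation functor at `g` in the direction `gY` (functoriality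
`Γ(g(1 + sY)) = Γ(g) Γ(1 + sY)` and `hasDerivAt_Gamma_one_add_smul_apply`). This is the Fock operator a
one-body source insertion `M ↦ M(1 + sY)` in a transfer matrix `Γ(M)` produces to first order.
Dereziński–Gérard Prop. 3.23 (1); Bratteli–Robinson II §5.2.1. [cite: DerezinskiGerard2022, Prop. 3.23] -/
theorem hasDerivAt_Gamma_mul_one_add_smul_apply (g Y : Matrix ι ι ℂ) (S T : Finset ι) :
    HasDerivAt (fun s : ℝ => Gamma (g * (1 + (s : ℂ) • Y)) S T) ((Gamma g * dGamma Y) S T) 0 := by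
  have hfun : (fun s : ℝ => Gamma (g * (1 + (s : ℂ) • Y)) S T) =
      fun s : ℝ => ∑ U, Gamma g S U * Gamma (1 + (s : ℂ) • Y) U T := by
    funext s
    rw [Gamma_mul, Matrix.mul_apply]
  rw [hfun, Matrix.mul_apply]
  exact HasDerivAt.fun_sum fun U _ => (hasDerivAt_Gamma_one_add_smul_apply Y U T).const_mul _

end Literature.MathematicalPhysics.QuantumLattice
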